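import Mathlib.NumberTheory.LegendreSymbol.QuadraticChar.Basic
import Mathlib.FieldTheory.Finite.Basic
import Mathlib.RingTheory.Polynomial.Pochhammer
import Mathlib.RingTheory.Polynomial.Basic
import Mathlib.Algebra.Polynomial.Div
import Mathlib.Algebra.Polynomial.Inductions
import Mathlib.Algebra.Polynomial.AlgebraMap
import Mathlib.Algebra.CharP.Lemmas
import Mathlib.Data.Nat.Prime.Factorial
import Mathlib.Algebra.Module.Equiv.Basic
import Mathlib.Algebra.Module.Submodule.Basic
import HarnessLib

/-!
# Route `ManinLocalTwoThree`, residual crux C5 `ManinPrimeToAdditiveFiveLe` (stmt-BirchSwinnertonDyer-22969),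
# registered stub `stub_ord57` (= `TwistFamilyManinDescent.OrdinaryCornerManinResidual`, stmt-27552), line
# «horocyclic-orientation» (publish-only, bsd-idea-8 g6), support stub `stub_notBottom_of_horocyclic57`,
# part 1/3: **the horocyclic transfer in the group ring `ℤ[ℤ/p]`** (route-independent, Mathlib only)

Width seat bsd-line-ml23-c5-p1-w3 (gen 3). BOTTOM(`f`, `χ`) (`g(χ)·Λ(f ⊗ χ) ⊆ p·Λ(f)`, Edixhoven's case 1 on the
twisted lattice; negated in K18b″ stmt-27662 and C1 stmt-25939) says, through Shimura's
`{∞, r}_{f⊗χ} = g(χ)⁻¹ Σ_u χ(u) {∞, r + u/p}_f`, that the `p`-periodic lattice-valued sequence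
`h(n) = {∞, A/C + n/p}_f` is killed modulo `p·Λ_f` by `r_χ = Σ_u χ(u) s^u ∈ ℤ[ℤ/p]` (`s` = shift). This file is the
pure algebra behind the line's support stub: `r_χ` generates, together with `p` and `s^p − 1`, an ideal containing
`(s − 1)^k`, `k = (p−1)/2`, because `r_χ(1+t) = −(1/k!)·t^k·(unit)` in `𝔽_p[t]/(t^p)` (Euler `χ(u) ≡ u^k`, power sums
over `𝔽_p`). Hence BOTTOM forces every horocyclic `k`-th difference `Σ_{i≤k} (−1)^i C(k,i) h(j+i)` into `p·Λ_f`
(parts 2/3, 3/3: files `…HorocyclicBottom`, `…NotBottomOfHorocyclic`).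

Main results (sorry-free, no named facts):
* §1 `horocyclic_sum_eval_eq_neg_coeff`, `horocyclic_sum_pow_mul_choose_eq_zero` / `_ne_zero` — power sums over
  `𝔽_p`: `Σ_{u ∈ 𝔽_p} u^k·C(u, m) = 0` for `m < k` and `≠ 0` for `m = k` (`m!·C(u,m)` = falling factorial).
* §2 `horocyclic_exists_X_sub_one_pow_eq_int` — in `ℤ[X]`: `(X − 1)^k = a·r_χ + b·(X^p − 1) + q`, `p ∣ q`
  coefficientwise, `r_χ = Σ_u χ_p(u) X^u` (`χ_p` = Legendre symbol = Mathlib's `quadraticChar (ZMod p)`).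
* §3 `horocyclic_transfer_abstract` — for a `p`-periodic `Λ`-valued sequence `h` in any abelian group:
  `Σ_u χ_p(u) h(j+u) ∈ pΛ (∀ j)` ⟹ `Σ_{i≤k} (−1)^i C(k,i) h(j+i) ∈ pΛ (∀ j)`.

Nothing about modular forms, C5, Manin's conjecture or BSD is proved in this file.

References: [MazurTateTeitelbaum1986Invent] §I.8 (twisted symbols); [Shimura1971] Prop. 3.64; crux dir
`Cruxes/ManinPrimeToAdditiveFiveLe/Lines/horocyclic-orientation.md` (line card, «stub_notBottom_of_horocyclic57»).
-/

set_option autoImplicit false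
-- the Theorems namespace of this sub repeats the summit name by design (D-0017 nested layout)
set_option linter.dupNamespace false

noncomputable section

open scoped Classical Polynomial

namespace Summit.BirchSwinnertonDyer.BirchSwinnertonDyer.Theorems

open Polynomial Finset

/-! ## §1 Power sums over `𝔽_p` -/

section PowerSums

variable {p : ℕ} [hp : Fact p.Prime]

/-- `Σ_{u ∈ 𝔽_p} u^{p−1} = −1` (Fermat: every non-zero term is `1`; there are `p − 1` of them). [folklore] -/
theorem horocyclic_sum_pow_card_sub_one : ∑ u : ZMod p, u ^ (p - 1) = -1 := by
  have hp1 : p - 1 ≠ 0 := Nat.sub_ne_zero_of_lt hp.out.one_lt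
  rw [← Finset.sum_erase_add _ _ (Finset.mem_univ (0 : ZMod p)), zero_pow hp1, add_zero,
    Finset.sum_congr rfl (fun u hu ↦ ZMod.pow_card_sub_one_eq_one (Finset.ne_of_mem_erase hu)),
    Finset.sum_const, Finset.card_erase_of_mem (Finset.mem_univ _), Finset.card_univ, ZMod.card,
    nsmul_eq_mul, mul_one, Nat.cast_sub hp.out.one_le, ZMod.natCast_self, Nat.cast_one, zero_sub]

/-- For `Q ∈ 𝔽_p[X]` of degree `< p`: `Σ_{u ∈ 𝔽_p} Q(u) = −(coefficient of X^{p−1})` (all lower power sums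
vanish). [folklore] -/
theorem horocyclic_sum_eval_eq_neg_coeff (Q : (ZMod p)[X]) (hQ : Q.natDegree < p) :
    ∑ u : ZMod p, Q.eval u = -Q.coeff (p - 1) := by
  have hp1 : p - 1 + 1 = p := Nat.sub_add_cancel hp.out.one_le
  simp_rw [Polynomial.eval_eq_sum_range' hQ]
  rw [Finset.sum_comm, show Finset.range p = Finset.range (p - 1 + 1) by rw [hp1], Finset.sum_range_succ,
    Finset.sum_eq_zero, zero_add, ← Finset.mul_sum, horocyclic_sum_pow_card_sub_one, mul_neg, mul_one]
  intro i hi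
  rw [← Finset.mul_sum, FiniteField.sum_pow_lt_card_sub_one (K := ZMod p) i (by
    rw [ZMod.card]; exact Finset.mem_range.mp hi), mul_zero]

/-- `m! · Σ_u u^k C(u, m) = Σ_u (X^k · (X)_m)(u)` with `(X)_m` the falling factorial. [folklore] -/
theorem horocyclic_factorial_mul_sum_pow_mul_choose (k m : ℕ) :
    (m.factorial : ZMod p) * ∑ u : ZMod p, u ^ k * ((u.val.choose m : ℕ) : ZMod p) =
      ∑ u : ZMod p, (X ^ k * descPochhammer (ZMod p) m).eval u := by
  rw [Finset.mul_sum]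
  refine Finset.sum_congr rfl fun u _ ↦ ?_
  have h : (descPochhammer (ZMod p) m).eval u = (m.factorial : ZMod p) * ((u.val.choose m : ℕ) : ZMod p) := by
    conv_lhs => rw [← ZMod.natCast_zmod_val u]
    rw [descPochhammer_eval_eq_descFactorial, Nat.descFactorial_eq_factorial_mul_choose, Nat.cast_mul]
  rw [Polynomial.eval_mul, Polynomial.eval_pow, Polynomial.eval_X, h]
  ring

/-- For `m < k ≤ (p−1)/2`: `Σ_{u ∈ 𝔽_p} u^k C(u, m) = 0`. [folklore] -/
theorem horocyclic_sum_pow_mul_choose_eq_zero {k m : ℕ} (hk : 2 * k + 1 ≤ p) (hm : m < k) :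
    ∑ u : ZMod p, u ^ k * ((u.val.choose m : ℕ) : ZMod p) = 0 := by
  have hfact : (m.factorial : ZMod p) ≠ 0 := by
    rw [Ne, ZMod.natCast_eq_zero_iff, hp.out.dvd_factorial]
    omega
  have hmonic : (X ^ k * descPochhammer (ZMod p) m).Monic := (monic_X_pow k).mul (monic_descPochhammer _ m)
  have hdeg : (X ^ k * descPochhammer (ZMod p) m).natDegree = k + m := by
    rw [(monic_X_pow k).natDegree_mul (monic_descPochhammer _ m), natDegree_X_pow, descPochhammer_natDegree]
  have h := horocyclic_factorial_mul_sum_pow_mul_choose (p := p) k m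
  rw [horocyclic_sum_eval_eq_neg_coeff _ (by rw [hdeg]; omega),
    Polynomial.coeff_eq_zero_of_natDegree_lt (by rw [hdeg]; omega), neg_zero] at h
  exact (mul_eq_zero.mp h).resolve_left hfact

/-- For `k = (p−1)/2`: `Σ_{u ∈ 𝔽_p} u^k C(u, k) ≠ 0` (it is `−1/k!`). [folklore] -/
theorem horocyclic_sum_pow_mul_choose_ne_zero {k : ℕ} (hk : 2 * k + 1 = p) :
    ∑ u : ZMod p, u ^ k * ((u.val.choose k : ℕ) : ZMod p) ≠ 0 := by
  have hmonic : (X ^ k * descPochhammer (ZMod p) k).Monic := (monic_X_pow k).mul (monic_descPochhammer _ k)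
  have hdeg : (X ^ k * descPochhammer (ZMod p) k).natDegree = p - 1 := by
    rw [(monic_X_pow k).natDegree_mul (monic_descPochhammer _ k), natDegree_X_pow, descPochhammer_natDegree]
    omega
  have h := horocyclic_factorial_mul_sum_pow_mul_choose (p := p) k k
  rw [horocyclic_sum_eval_eq_neg_coeff _ (by rw [hdeg]; omega), ← hdeg, hmonic.coeff_natDegree] at h
  intro h0
  rw [h0, mul_zero] at h
  exact one_ne_zero (neg_eq_zero.mp h.symm)

end PowerSums

/-! ## §2 The group-ring identity `(X − 1)^k ∈ (p, X^p − 1, r_χ)` -/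

section GroupRing

variable {p : ℕ} [hp : Fact p.Prime]

/-- Over `𝔽_p`: `(X − 1)^k = a · Σ_u u^k X^u + b · (X^p − 1)` for some `a, b ∈ 𝔽_p[X]`, `k = (p−1)/2`, `p` odd.
Mechanism: the Taylor expansion of `r = Σ_u u^k X^u` at `X = 1` starts at order exactly `k` (§1), so
`r(X+1) = X^k · v` with `v(0) ≠ 0`, `v` is prime to `X^{k+1}`, `X^k = b·r(X+1) + a·X^p`, and `X ↦ X − 1` with
`(X − 1)^p = X^p − 1` in characteristic `p`. [folklore] -/
theorem horocyclic_exists_X_sub_one_pow_eq_zmod (hp2 : p ≠ 2) :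
    ∃ a b : (ZMod p)[X], (X - 1) ^ ((p - 1) / 2) =
      a * (∑ u : ZMod p, C (u ^ ((p - 1) / 2)) * X ^ u.val) + b * (X ^ p - 1) := by
  have hodd : p % 2 = 1 := Nat.odd_iff.mp (hp.out.eq_two_or_odd'.resolve_left hp2)
  set k : ℕ := (p - 1) / 2 with hk
  have hkp : 2 * k + 1 = p := by omega
  set r : (ZMod p)[X] := ∑ u : ZMod p, C (u ^ k) * X ^ u.val with hr
  set R₁ : (ZMod p)[X] := r.comp (X + 1) with hR₁
  have hR₁' : R₁ = ∑ u : ZMod p, C (u ^ k) * (X + 1) ^ u.val := by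
    rw [hR₁, hr, ← Polynomial.coe_compRingHom_apply, map_sum]
    refine Finset.sum_congr rfl fun u _ ↦ ?_
    rw [Polynomial.coe_compRingHom_apply, Polynomial.mul_comp, Polynomial.C_comp, Polynomial.X_pow_comp]
  have hcoeff : ∀ m, R₁.coeff m = ∑ u : ZMod p, u ^ k * ((u.val.choose m : ℕ) : ZMod p) := by
    intro m
    rw [hR₁', Polynomial.finsetSum_coeff]
    refine Finset.sum_congr rfl fun u _ ↦ ?_
    rw [Polynomial.coeff_C_mul, Polynomial.coeff_X_add_one_pow]
  have hlow : ∀ m < k, R₁.coeff m = 0 := fun m hm ↦ by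
    rw [hcoeff]; exact horocyclic_sum_pow_mul_choose_eq_zero hkp.le hm
  have hkc : R₁.coeff k ≠ 0 := by rw [hcoeff]; exact horocyclic_sum_pow_mul_choose_ne_zero hkp
  obtain ⟨v, hv⟩ : X ^ k ∣ R₁ := Polynomial.X_pow_dvd_iff.mpr hlow
  have hv0 : v.coeff 0 ≠ 0 := by
    have e := Polynomial.coeff_X_pow_mul v k 0
    rw [zero_add, ← hv] at e
    rwa [e] at hkc
  -- `v` is prime to `X`, hence to `X^(k+1)`
  have hXv : IsCoprime (X : (ZMod p)[X]) v := by
    refine ⟨-(C (v.coeff 0)⁻¹ * v.divX), C (v.coeff 0)⁻¹, ?_⟩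
    have h := Polynomial.X_mul_divX_add v
    calc -(C (v.coeff 0)⁻¹ * v.divX) * X + C (v.coeff 0)⁻¹ * v
        = C (v.coeff 0)⁻¹ * (v - X * v.divX) := by ring
      _ = C (v.coeff 0)⁻¹ * C (v.coeff 0) := by
          congr 1
          linear_combination (-1 : (ZMod p)[X]) * h
      _ = 1 := by rw [← C_mul, inv_mul_cancel₀ hv0, C_1]
  obtain ⟨a, b, hab⟩ := hXv.pow_left (m := k + 1)
  have hXk : (X : (ZMod p)[X]) ^ k = b * R₁ + a * X ^ p := by
    calc (X : (ZMod p)[X]) ^ k = X ^ k * (a * X ^ (k + 1) + b * v) := by rw [hab, mul_one]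
      _ = b * (X ^ k * v) + a * X ^ (k + (k + 1)) := by rw [pow_add]; ring
      _ = b * R₁ + a * X ^ p := by rw [← hv, show k + (k + 1) = p by omega]
  refine ⟨b.comp (X - 1), a.comp (X - 1), ?_⟩
  have hfrob : ((X : (ZMod p)[X]) - 1) ^ p = X ^ p - 1 := by rw [sub_pow_char, one_pow]
  have hcomp : ((X : (ZMod p)[X]) ^ k).comp (X - 1) = (b * R₁ + a * X ^ p).comp (X - 1) := by rw [hXk]
  rw [Polynomial.X_pow_comp, Polynomial.add_comp, Polynomial.mul_comp, Polynomial.mul_comp,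
    Polynomial.X_pow_comp, hR₁, Polynomial.comp_assoc, Polynomial.add_comp, Polynomial.X_comp,
    Polynomial.one_comp, sub_add_cancel, Polynomial.comp_X, hfrob] at hcomp
  rw [hcomp]

/-- Over `ℤ`: `(X − 1)^k = a · r_χ + b · (X^p − 1) + q` with `r_χ = Σ_u χ_p(u) X^u` (`χ_p` the Legendre symbol,
`u ∈ [0, p)`) and every coefficient of `q` divisible by `p` (lift of the `𝔽_p` identity; Euler's criterion
`χ_p(u) ≡ u^k`). [folklore] -/
theorem horocyclic_exists_X_sub_one_pow_eq_int (hp2 : p ≠ 2) :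
    ∃ a b q : ℤ[X], (∀ n, (p : ℤ) ∣ q.coeff n) ∧
      (X - 1) ^ ((p - 1) / 2) =
        a * (∑ u : ZMod p, C ((quadraticChar (ZMod p) u : ℤ)) * X ^ u.val) + b * (X ^ p - 1) + q := by
  have hodd : p % 2 = 1 := Nat.odd_iff.mp (hp.out.eq_two_or_odd'.resolve_left hp2)
  set k : ℕ := (p - 1) / 2 with hk
  have hk2 : p / 2 = k := by omega
  obtain ⟨a, b, hab⟩ := horocyclic_exists_X_sub_one_pow_eq_zmod (p := p) hp2
  have hsurj : Function.Surjective (Int.castRingHom (ZMod p)) := ZMod.intCast_surjective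
  obtain ⟨A, hA⟩ := Polynomial.map_surjective _ hsurj a
  obtain ⟨B, hB⟩ := Polynomial.map_surjective _ hsurj b
  set r : ℤ[X] := ∑ u : ZMod p, C ((quadraticChar (ZMod p) u : ℤ)) * X ^ u.val with hr
  have hF : ringChar (ZMod p) ≠ 2 := by rw [ZMod.ringChar_zmod_n]; exact hp2
  have hrmap : r.map (Int.castRingHom (ZMod p)) = ∑ u : ZMod p, C (u ^ k) * X ^ u.val := by
    rw [hr, Polynomial.map_sum]
    refine Finset.sum_congr rfl fun u _ ↦ ?_
    rw [Polynomial.map_mul, Polynomial.map_pow, Polynomial.map_X, Polynomial.map_C, eq_intCast,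
      quadraticChar_eq_pow_of_char_ne_two' hF, ZMod.card, hk2]
  set q : ℤ[X] := (X - 1) ^ k - (A * r + B * (X ^ p - 1)) with hq
  refine ⟨A, B, q, fun n ↦ ?_, by rw [hq]; ring⟩
  have hmap : q.map (Int.castRingHom (ZMod p)) = 0 := by
    rw [hq, Polynomial.map_sub, Polynomial.map_add, Polynomial.map_mul, Polynomial.map_mul, hA, hB, hrmap]
    simp only [Polynomial.map_pow, Polynomial.map_sub, Polynomial.map_X, Polynomial.map_one]
    rw [hab, sub_self]
  have hc := congrArg (fun s : (ZMod p)[X] ↦ s.coeff n) hmap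
  simp only [Polynomial.coeff_map, Polynomial.coeff_zero, eq_intCast] at hc
  exact (ZMod.intCast_zmod_eq_zero_iff_dvd _ p).mp hc

end GroupRing

/-! ## §3 The abstract transfer on `p`-periodic lattice-valued sequences -/

section Transfer

variable {M : Type*} [AddCommGroup M]

/-- Iterates of the shift `(T g)(j) = g(j+1)` on `ℤ → M`: `(T^n g)(j) = g(j + n)`. [folklore] -/
theorem horocyclic_shift_pow_apply (n : ℕ) (g : ℤ → M) (j : ℤ) :
    ((LinearMap.funLeft ℤ M (fun i : ℤ ↦ i + 1) ^ n) g) j = g (j + n) := by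
  induction n generalizing j with
  | zero => simp
  | succ n ih =>
    rw [pow_succ', Module.End.mul_apply, LinearMap.funLeft_apply, ih]
    congr 1
    push_cast
    ring

/-- Evaluation of `P(T)·g` for `P = Σ_i c_i X^{e_i}`: `(P(T) g)(j) = Σ_i c_i • g(j + e_i)`. [folklore] -/
theorem horocyclic_aeval_shift_sum_apply {ι : Type*} (s : Finset ι) (c : ι → ℤ) (e : ι → ℕ) (g : ℤ → M)
    (j : ℤ) :
    (Polynomial.aeval (LinearMap.funLeft ℤ M (fun i : ℤ ↦ i + 1)) (∑ i ∈ s, C (c i) * X ^ (e i)) g) j =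
      ∑ i ∈ s, c i • g (j + e i) := by
  rw [map_sum, LinearMap.sum_apply, Finset.sum_apply]
  refine Finset.sum_congr rfl fun i _ ↦ ?_
  rw [map_mul, Polynomial.aeval_C, Polynomial.aeval_X_pow, Module.End.mul_apply, Module.algebraMap_end_apply,
    Pi.smul_apply, horocyclic_shift_pow_apply]

/-- The set `{P ∈ ℤ[X] : P(T)·g ⊆ 𝓛 pointwise}` is closed under multiplication by `ℤ[X]` (`𝓛` any subgroup).
[folklore] -/
theorem horocyclic_aeval_mul_apply_mem (𝓛 : AddSubgroup M) (g : ℤ → M) (P : ℤ[X])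
    (hP : ∀ j, (Polynomial.aeval (LinearMap.funLeft ℤ M (fun i : ℤ ↦ i + 1)) P g) j ∈ 𝓛) (Q : ℤ[X]) :
    ∀ j, (Polynomial.aeval (LinearMap.funLeft ℤ M (fun i : ℤ ↦ i + 1)) (Q * P) g) j ∈ 𝓛 := by
  induction Q using Polynomial.induction_on with
  | C a =>
    intro j
    rw [map_mul, Polynomial.aeval_C, Module.End.mul_apply, Module.algebraMap_end_apply, Pi.smul_apply]
    exact 𝓛.zsmul_mem (hP j) a
  | add Q₁ Q₂ h₁ h₂ =>
    intro j
    rw [add_mul, map_add, LinearMap.add_apply, Pi.add_apply]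
    exact 𝓛.add_mem (h₁ j) (h₂ j)
  | monomial n a h =>
    intro j
    rw [show C a * X ^ (n + 1) * P = X * (C a * X ^ n * P) by ring, map_mul, Polynomial.aeval_X,
      Module.End.mul_apply, LinearMap.funLeft_apply]
    exact h (j + 1)

/-- **Abstract horocyclic transfer.** Let `p` be an odd prime, `k = (p−1)/2`, `Λ ≤ M` a subgroup of an abelian group
and `h : ℤ → Λ` a `p`-periodic sequence. If `Σ_{u mod p} χ_p(u) h(j + u) ∈ p·Λ` for every `j` (`χ_p` = Legendre),
then `Σ_{i ≤ k} (−1)^i C(k,i) h(j + i) ∈ p·Λ` for every `j`. Proof: the polynomials `P ∈ ℤ[X]` with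
`(P(T)h)(j) ∈ pΛ ∀ j` form an ideal containing `p`, `X^p − 1` and `r_χ`, hence `(X − 1)^k` (§2), hence
`(1 − X)^k = Σ (−1)^i C(k,i) X^i`. [folklore] -/
theorem horocyclic_transfer_abstract (Λ : AddSubgroup M) {p : ℕ} [hp : Fact p.Prime] (hp2 : p ≠ 2) (h : ℤ → M)
    (hper : ∀ n : ℤ, h (n + p) = h n) (hmem : ∀ n, h n ∈ Λ)
    (hbot : ∀ j : ℤ, ∃ y ∈ Λ, ∑ u : ZMod p, (quadraticChar (ZMod p) u : ℤ) • h (j + u.val) = (p : ℤ) • y)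
    (j : ℤ) :
    ∃ y ∈ Λ, ∑ i ∈ Finset.range ((p - 1) / 2 + 1),
      ((-1) ^ i * (((p - 1) / 2).choose i : ℕ) : ℤ) • h (j + i) = (p : ℤ) • y := by
  set T := LinearMap.funLeft ℤ M (fun i : ℤ ↦ i + 1) with hT
  set PΛ : AddSubgroup M := Λ.map (zsmulAddGroupHom (p : ℤ)) with hPΛ
  have memPΛ : ∀ x, x ∈ PΛ ↔ ∃ y ∈ Λ, (p : ℤ) • y = x := fun x ↦ by
    simp only [hPΛ, AddSubgroup.mem_map, zsmulAddGroupHom_apply]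
  set k : ℕ := (p - 1) / 2 with hk
  set r : ℤ[X] := ∑ u : ZMod p, C ((quadraticChar (ZMod p) u : ℤ)) * X ^ u.val with hr
  obtain ⟨a, b, q, hq, hid⟩ := horocyclic_exists_X_sub_one_pow_eq_int (p := p) hp2
  -- the three generators act into `pΛ`
  have Hr : ∀ j, (aeval T r h) j ∈ PΛ := by
    intro j
    rw [hr, hT, horocyclic_aeval_shift_sum_apply]
    obtain ⟨y, hy, e⟩ := hbot j
    exact (memPΛ _).mpr ⟨y, hy, e.symm⟩
  have Hper : ∀ j, (aeval T ((X : ℤ[X]) ^ p - 1) h) j ∈ PΛ := by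
    intro j
    have e : (aeval T ((X : ℤ[X]) ^ p - 1) h) j = h (j + p) - h j := by
      rw [map_sub, Polynomial.aeval_X_pow, map_one, LinearMap.sub_apply, Pi.sub_apply, hT,
        horocyclic_shift_pow_apply, Module.End.one_apply]
    rw [e, hper, sub_self]
    exact PΛ.zero_mem
  have Hq : ∀ j, (aeval T q h) j ∈ PΛ := by
    intro j
    rw [Polynomial.aeval_eq_sum_range, LinearMap.sum_apply, Finset.sum_apply]
    refine PΛ.sum_mem fun i _ ↦ ?_
    obtain ⟨c, hc⟩ := hq i
    rw [LinearMap.smul_apply, Pi.smul_apply, hT, horocyclic_shift_pow_apply, hc, mul_smul]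
    exact (memPΛ _).mpr ⟨c • h (j + i), Λ.zsmul_mem (hmem _) c, rfl⟩
  -- hence `(1 - X)^k = (-1)^k (a r + b (X^p - 1) + q)` does
  have Hall : (aeval T (((1 : ℤ[X]) - X) ^ k) h) j ∈ PΛ := by
    have e : ((1 : ℤ[X]) - X) ^ k = ((-1) ^ k * a) * r + ((-1) ^ k * b) * (X ^ p - 1) + (-1) ^ k * q := by
      rw [show ((1 : ℤ[X]) - X) ^ k = (-1) ^ k * (X - 1) ^ k by rw [← mul_pow]; congr 1; ring, hid]
      ring
    rw [e, map_add, map_add, LinearMap.add_apply, LinearMap.add_apply, Pi.add_apply, Pi.add_apply]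
    exact PΛ.add_mem (PΛ.add_mem (horocyclic_aeval_mul_apply_mem PΛ h r Hr _ j)
      (horocyclic_aeval_mul_apply_mem PΛ h _ Hper _ j)) (horocyclic_aeval_mul_apply_mem PΛ h q Hq _ j)
  -- and `(1 - X)^k = Σ (-1)^i C(k,i) X^i`
  have hexp : ((1 : ℤ[X]) - X) ^ k = ∑ i ∈ Finset.range (k + 1), C ((-1) ^ i * (k.choose i : ℕ) : ℤ) * X ^ i := by
    rw [sub_eq_add_neg, add_comm, add_pow]
    refine Finset.sum_congr rfl fun i _ ↦ ?_
    rw [one_pow, mul_one, neg_pow, map_mul, map_pow, map_neg, map_one, map_natCast]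
    ring
  rw [hexp, hT, horocyclic_aeval_shift_sum_apply] at Hall
  obtain ⟨y, hy, e⟩ := (memPΛ _).mp Hall
  exact ⟨y, hy, e.symm⟩

end Transfer

end Summit.BirchSwinnertonDyer.BirchSwinnertonDyer.Theorems

end
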